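import Summits.QuantumAdvantage.QuantumAdvantage.Theorems.CharDialNullDialA
import HarnessLib

/-!
# The null dial, part B: the summit format `nullDialLog_hard` and ★★ `resY_hard` — the named residual instance DECIDED (decomp-qadv lens-6 g18 «NullDial», tree part 31B)

(1) `nullDialLog_hard`: there are `θ < 1` and `n₀` (uniform in the modulus `p` and the window length `ℓ`) such that for all `n ≥ n₀`, every junta ⊕
linear-form presentation mod `p` with juntas `≤ log₂ n` whose forms are ZERO-SUM on `M ≥ 2^ℓ·((log₂ n+1)²+1)` pairwise separated `ℓ`-windows,
`ℓ ≢ 0 (mod 3)`, wins the mod-3 walk game on at most `θ·2ⁿ` inputs (from part A `nullDial_hard`; no primality).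
(2) THE NAMED INSTANCE.  `resY p n` (annex §37v): cut `g` answers `[g ≡ F_g(u) (mod p)]`, `F_g` the form with coefficients `resCoef p n (g/p)`:
the `(p−1)`-periodic non-zero pattern `ρ(i) = (i mod (p−1)) + 1` on the sensitive coordinates (`i < p·(g/p)` or `i ≥ p·sepM`, `sepM = n/3/p`), `0`
on the ignored ones.  In the annex it is HIGH-variation and every `log₂ n`-junta presentation of it escapes the rank dial, the sparse dial and the
block dial (REV16–17: the first named open instance of the three-dial residual).  Its canonical presentation MEETS the null dial with `ℓ = 2`:
the tail pattern puts the complementary pair `ρ = (p−1)/2, (p+1)/2` on ADJACENT coordinates once per period (`resData_null`), whence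
★★ `resY_hard`: for every prime `p ≥ 5`, `∃ θ < 1, ∃ n₀, ∀ n ≥ n₀, ∀ c, #{u : resY wins} ≤ θ·2ⁿ` — unconditionally.
Supports item stmt-QuantumAdvantage-32604 (`CharDial.WalkHardFJLinOdd`); source: pub annex g18/OrbitDial38.lean (sha256 0bc87d36…) §38d (`nullDialLog_hard`,
`blk_two_eq`, `rho_pair_eq_zero`, `resData_nullHyp`, `resY_hard`) and §37v (`rho`, `resCoef`, `resY`, `resData`, `sepM`), namespace
`…Theses.OrbitDial`, statements verbatim with the Prop `NullHyp` INLINED and the annex's `form` unfolded (Prop-free twin).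
-/

set_option autoImplicit false

namespace Summit.QuantumAdvantage.AdviceFreeQNC0.JLinPeel.NullDial

open Finset
open Summit.QuantumAdvantage.AdviceFreeQNC0
open Summit.QuantumAdvantage.AdviceFreeQNC0.JLinPeel.BlockDial
open Literature.Computability.MetaComplexity Literature.Computability.MetaComplexity.Smolensky

section SummitFormat

/-- ★ **the null dial in the summit's format** (juntas `≤ log₂ n`, threshold `2^ℓ·((log₂ n+1)²+1)` explicit; `θ, n₀` uniform in `p, ℓ`). -/
theorem nullDialLog_hard :
    ∃ θ : ℝ, θ < 1 ∧ ∃ n₀ : ℕ, ∀ (ℓ : ℕ), (ℓ % 3 = 1 ∨ ℓ % 3 = 2) → ∀ (p n : ℕ), n₀ ≤ n → ∀ (M : ℕ) (S : Fin M → ℕ),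
      ((∀ k k', k < k' → S k + ℓ ≤ S k') ∧ (∀ k, S k + ℓ ≤ n)) →
      2 ^ ℓ * ((Nat.log 2 n + 1) * (Nat.log 2 n + 1) + 1) ≤ M →
      ∀ (c : ℕ) (D : JLinPeel.JLinData p n), (∀ g, (D.J g).card ≤ Nat.log 2 n) →
        (∀ g (k : Fin M), ∑ i ∈ blk ℓ S k, D.a g i = 0) →
        ((univ.filter fun u : Fin n → Bool => ringWinU c D.strat u = true).card : ℝ) ≤ θ * (2 : ℝ) ^ n := by
  obtain ⟨θ, hθ, N₁, hN⟩ := nullDial_hard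
  refine ⟨θ, hθ, 2 ^ N₁, fun ℓ hℓ3 p n hn M S hS hM c D hJ hnull => ?_⟩
  have hlog : N₁ ≤ Nat.log 2 n := by
    have h := Nat.log_mono_right (b := 2) hn
    rwa [Nat.log_pow (by norm_num : 1 < 2)] at h
  have h1 : 2 ^ ℓ * (N₁ + 1) ≤ M :=
    le_trans (Nat.mul_le_mul_left _ (by nlinarith)) hM
  exact hN ℓ hℓ3 p n M (Nat.log 2 n) S hS h1 hM c D hJ hnull

end SummitFormat

section ResY
variable {p : ℕ}

/-! #### the residual family `resY` of the annex (§37t/§37v), verbatim -/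

/-- number of leading aligned `p`-blocks used by the block-prefix part: `n/3/p`. -/
def sepM (p n : ℕ) : ℕ := n / 3 / p

/-- the block-prefix zone `[0, p·sepM)` lies inside the first third. -/
theorem p_mul_sepM_le (p n : ℕ) : p * sepM p n ≤ n / 3 := by
  unfold sepM
  rw [mul_comm]
  exact Nat.div_mul_le_self (n / 3) p

/-- the `(p−1)`-periodic non-zero pattern `ρ(i) = (i mod (p−1)) + 1`. -/
def rho (p i : ℕ) : ZMod p := (((i % (p - 1) + 1 : ℕ)) : ZMod p)

/-- coefficient vector with block-prefix parameter `q`: `ρ` on the sensitive coordinates, `0` on the ignored ones. -/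
def resCoef (p n q : ℕ) : Fin n → ZMod p := fun i =>
  if i.val < p * sepM p n then (if i.val < p * q then rho p i.val else 0) else rho p i.val

/-- **the residual family**: cut `g` outputs `[g ≡ F_g(u) (mod p)]` with `F_g` the form of `resCoef p n (g / p)` (the annex's `form` unfolded). -/
def resY (p n : ℕ) : Fin (n + 1) → (Fin n → Bool) → Bool :=
  fun g u => decide ((((g : ℕ) : ZMod p)) = ∑ i, if u i then resCoef p n (g.val / p) i else 0)

/-- its canonical junta-free presentation. -/
def resData (p n : ℕ) : JLinPeel.JLinData p n where
  J := fun _ => ∅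
  a := fun g => resCoef p n (g.val / p)
  h := fun g _ s => decide ((((g : ℕ) : ZMod p)) = s)
  hJ := fun _ _ _ _ _ => rfl

/-- the presentation presents `resY`. -/
theorem resData_strat (p n : ℕ) : (resData p n).strat = resY p n := rfl

/-- its juntas are empty. -/
theorem resData_J (p n : ℕ) (g : Fin (n + 1)) : (resData p n).J g = ∅ := rfl

/-! #### ★★ `resY` meets the null dial with `ℓ = 2` -/

/-- the two-element window. -/
theorem blk_two_eq {n M : ℕ} (S : Fin M → ℕ) (k : Fin M) (h : S k + 2 ≤ n) :
    blk 2 S k = ({(⟨S k, by omega⟩ : Fin n), (⟨S k + 1, by omega⟩ : Fin n)} : Finset (Fin n)) := by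
  ext i
  rw [mem_blk, Finset.mem_insert, Finset.mem_singleton, Fin.ext_iff, Fin.ext_iff]
  simp only
  omega

/-- the COMPLEMENTARY PAIR of `ρ`: at a coordinate `t ≡ (p−3)/2 (mod p−1)` the adjacent values are `(p−1)/2, (p+1)/2`, summing to `p ≡ 0`
(`p` odd, `p ≥ 3`). -/
theorem rho_pair_eq_zero (hp3 : 3 ≤ p) (hodd : p % 2 = 1) {t : ℕ} (ht : t % (p - 1) = (p - 3) / 2) : rho p t + rho p (t + 1) = 0 := by
  have hm : 2 ≤ p - 1 := by omega
  have hr : (p - 3) / 2 + 1 < p - 1 := by omega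
  have ht1 : (t + 1) % (p - 1) = (p - 3) / 2 + 1 := by
    rw [Nat.add_mod, ht, Nat.mod_eq_of_lt (by omega : 1 < p - 1), Nat.mod_eq_of_lt hr]
  unfold rho
  rw [ht, ht1, ← Nat.cast_add]
  have e : (p - 3) / 2 + 1 + ((p - 3) / 2 + 1 + 1) = p := by omega
  rw [e, ZMod.natCast_self]

/-- ★★ **the canonical presentation of `resY` meets the null dial** (`p` odd `≥ 3`, all large `n`): `M = 4·((log₂ n+1)²+1)` separated windows
`{t, t+1}`, `t ≡ (p−3)/2 (mod p−1)`, in the tail zone `t ≥ p·sepM`, on each of which every cut's coefficient vector sums to `0`. -/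
theorem resData_null (p : ℕ) (hp3 : 3 ≤ p) (hodd : p % 2 = 1) : ∃ n₁ : ℕ, ∀ n ≥ n₁,
    ∃ (M : ℕ) (S : Fin M → ℕ), ((∀ k k' : Fin M, k < k' → S k + 2 ≤ S k') ∧ (∀ k : Fin M, S k + 2 ≤ n)) ∧
      2 ^ 2 * ((Nat.log 2 n + 1) * (Nat.log 2 n + 1) + 1) ≤ M ∧
        ∀ g (k : Fin M), ∑ i ∈ blk 2 S k, (resData p n).a g i = 0 := by
  obtain ⟨m₀, hm₀⟩ := DWalk.const_mul_logPow_le' (33 * (p - 1)) 2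
  refine ⟨max m₀ 4, fun n hn => ?_⟩
  have hn₀ : m₀ ≤ n := le_trans (le_max_left _ _) hn
  have hn4 : 4 ≤ n := le_trans (le_max_right _ _) hn
  have hlog := hm₀ n hn₀
  have hL1 : 1 ≤ Nat.log 2 n := Nat.log_pos (by norm_num) (by omega)
  set m : ℕ := p - 1 with hm
  set r : ℕ := (p - 3) / 2 with hr
  set L : ℕ := Nat.log 2 n with hL
  set M : ℕ := 2 ^ 2 * ((L + 1) * (L + 1) + 1) with hM
  set q₀ : ℕ := p * sepM p n / m + 1 with hq₀
  have hm2 : 2 ≤ m := by omega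
  have hm0 : 0 < m := by omega
  have hrm : r + 2 ≤ m := by omega
  have hsep3 := p_mul_sepM_le p n
  have hq₀e : m * q₀ = p * sepM p n / m * m + m := by rw [hq₀]; ring
  have hq₀m : p * sepM p n < m * q₀ := by
    have h1 := Nat.lt_div_mul_add (a := p * sepM p n) hm0
    omega
  have hq₀le : m * q₀ ≤ n / 3 + m := by
    have h1 := Nat.div_mul_le_self (p * sepM p n) m
    omega
  have hML : M ≤ 20 * L ^ 2 := by
    rw [hM]
    have : (L + 1) * (L + 1) + 1 ≤ 5 * L ^ 2 := by nlinarith [hL1]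
    omega
  have hbudget : m * q₀ + m * M + r + 2 ≤ n := by
    have h1 : m * M ≤ 20 * (m * L ^ 2) := by nlinarith [hML]
    have h2 : 33 * (p - 1) * L ^ 2 = 33 * (m * L ^ 2) := by rw [hm]; ring
    rw [h2] at hlog
    have h3 : 3 * (n / 3) ≤ n := Nat.mul_div_le n 3
    have h4 : m * L ^ 2 ≥ m := by nlinarith [hL1]
    omega
  let S : Fin M → ℕ := fun k => m * (q₀ + k.val) + r
  have hSfit : ∀ k : Fin M, S k + 2 ≤ n := by
    intro k
    show m * (q₀ + k.val) + r + 2 ≤ n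
    have hk : k.val + 1 ≤ M := k.isLt
    have : m * (q₀ + k.val) ≤ m * q₀ + m * M := by
      rw [Nat.mul_add]; exact Nat.add_le_add_left (Nat.mul_le_mul_left _ (by omega)) _
    omega
  have hSsep : ∀ k k' : Fin M, k < k' → S k + 2 ≤ S k' := by
    intro k k' hkk
    show m * (q₀ + k.val) + r + 2 ≤ m * (q₀ + k'.val) + r
    have hlt : q₀ + k.val + 1 ≤ q₀ + k'.val := by have : k.val + 1 ≤ k'.val := hkk; omega
    have h1 : m * (q₀ + k.val + 1) ≤ m * (q₀ + k'.val) := Nat.mul_le_mul_left _ hlt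
    rw [Nat.mul_add, mul_one] at h1
    omega
  have hSmod : ∀ k : Fin M, S k % m = r := by
    intro k
    show (m * (q₀ + k.val) + r) % m = r
    rw [Nat.mul_add_mod, Nat.mod_eq_of_lt (by omega)]
  have hStail : ∀ k : Fin M, p * sepM p n ≤ S k := by
    intro k
    show p * sepM p n ≤ m * (q₀ + k.val) + r
    have : m * q₀ ≤ m * (q₀ + k.val) := Nat.mul_le_mul_left _ (Nat.le_add_right _ _)
    omega
  refine ⟨M, S, ⟨hSsep, hSfit⟩, le_of_eq hM.symm, fun g k => ?_⟩
  rw [blk_two_eq S k (hSfit k), Finset.sum_pair (by rw [Ne, Fin.ext_iff]; simp)]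
  show resCoef p n (g.val / p) ⟨S k, _⟩ + resCoef p n (g.val / p) ⟨S k + 1, _⟩ = 0
  have h1 : resCoef p n (g.val / p) ⟨S k, by have := hSfit k; omega⟩ = rho p (S k) := by
    unfold resCoef
    rw [if_neg (by simp only; have := hStail k; omega)]
  have h2 : resCoef p n (g.val / p) ⟨S k + 1, by have := hSfit k; omega⟩ = rho p (S k + 1) := by
    unfold resCoef
    rw [if_neg (by simp only; have := hStail k; omega)]
  rw [h1, h2]
  exact rho_pair_eq_zero hp3 hodd (by rw [← hr]; exact hSmod k)

/-- primes `p ≥ 5` (indeed `≥ 3`) are odd. -/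
theorem odd_of_prime_ge5 (hp : p.Prime) (h5 : 5 ≤ p) : p % 2 = 1 := by
  rcases Nat.Prime.eq_two_or_odd hp with h | h
  · omega
  · exact h

/-- ★★ **`ResYHard` DECIDED.**  For every prime `p ≥ 5` the explicit residual family `resY p n` wins the mod-3 walk game with shift `c` on at most
`θ·2ⁿ` inputs for all large `n` — unconditionally, by the null dial at `ℓ = 2` on its canonical presentation. -/
theorem resY_hard (p : ℕ) [hp : Fact p.Prime] (hp5 : 5 ≤ p) :
    ∃ θ : ℝ, θ < 1 ∧ ∃ n₀ : ℕ, ∀ n ≥ n₀, ∀ c : ℕ,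
      ((univ.filter fun u : Fin n → Bool => ringWinU c (resY p n) u = true).card : ℝ) ≤ θ * (2 : ℝ) ^ n := by
  obtain ⟨θ, hθ, n₀, hn₀⟩ := nullDialLog_hard
  obtain ⟨n₁, hn₁⟩ := resData_null p (by omega) (odd_of_prime_ge5 hp.out hp5)
  refine ⟨θ, hθ, max n₀ n₁, fun n hn c => ?_⟩
  obtain ⟨M, S, hS, hM, hnull⟩ := hn₁ n (le_of_max_le_right hn)
  rw [← resData_strat p n]
  exact hn₀ 2 (Or.inr rfl) p n (le_of_max_le_left hn) M S hS hM c (resData p n) (fun g => by rw [resData_J]; simp) hnull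

end ResY

end Summit.QuantumAdvantage.AdviceFreeQNC0.JLinPeel.NullDial
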